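import Literature.AlgebraicGeometry.Motives.FamiliesVHSTensor
import Literature.AlgebraicGeometry.Motives.FamiliesVHSDual
import Literature.AlgebraicGeometry.Motives.MixedHodgeStructureLerayAssembly
import Mathlib.LinearAlgebra.Contraction
import Mathlib.RingTheory.TensorProduct.IsBaseChangeHom
import HarnessLib

/-!
# The variation `Hom(D₁, D₂) = D₁^∨ ⊗ D₂` of two polarized variations of Hodge structure, the lattice class of a `ℤ`-linear map
# `f : V₁,ℤ,s → V₂,ℤ,s`, and «`f` is an integral Hodge class of `Hom(D₁, D₂)` at `s` ⟺ `f_ℚ` is a morphism of Hodge structures»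

Topic `Literature/AlgebraicGeometry/Motives` (namespace `Literature.AlgebraicGeometry.Motives.VHSData`), lane `lit-hodgefound` (seat `p08`, row g56-#11).
DEFINITIONS WITH BODIES (`VHSData.cast`, `VHSData.hom`, `VHSData.homClass`, `VHSData.homRat`) and their API; no named fact, no instance, no notation
(D-0026 net debt `0`).  Built on `Motives/FamiliesVHSTensor` (`D₁ ⊗ D₂`) and `Motives/FamiliesVHSDual` (`D^∨`, `isBaseChange_toRatLinear`).

PRINTED SOURCES.  P. Deligne, *Équations différentielles à points singuliers réguliers*, LNM 163 (1970), I.1 (local systems: `⊗`-category with internal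
`Hom` and duals, `Hom(V₁, V₂) = V₁^∨ ⊗ V₂`).  P. Griffiths, *Periods of integrals III*, Publ. Math. IHÉS 38 (1970), §1 ∕ W. Schmid, *Variation of Hodge
structure*, Invent. Math. 22 (1973), §2 (variations are stable under `Hom`, duals, `⊗`).  P. Deligne, *Théorie de Hodge II*, 1.1.6 and 2.1 ∕ C. Voisin,
*Hodge Theory I*, Lemma 7.25 ∕ §11.1: the internal `Hom` of Hodge structures, and «a `ℚ`-linear map `f : V₁ → V₂` is a morphism of Hodge structures
iff `f` is a Hodge class of type `(0,0)` of `Hom(H₁, H₂) ≅ H₁^∨ ⊗ H₂`» — the principle that turns the locus where a flat family of lattice maps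
`f_s : V₁,ℤ,s → V₂,ℤ,s` (an isogeny, an endomorphism, a projector) respects the Hodge structures into a HODGE LOCUS of the variation `Hom(D₁, D₂)`, to
which Cattani–Deligne–Kaplan applies (E. Cattani, P. Deligne, A. Kaplan, *On the locus of Hodge classes*, J. AMS 8 (1995), §1; the «tensorial Hodge
loci» of Klingler–Otwinowska–Urbanik §1.1).  N. Bourbaki, *Algebra I*, Ch. II §4 no. 2 and §5 no. 4: for `M₁` finitely generated free,
`Hom(M₁, ℤ) ⊗ M₂ ⥲ Hom(M₁, M₂)` and base change commutes with `Hom` (Mathlib `dualTensorHomEquiv`, `IsBaseChange.linearMapLeftRightHom`).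

* §1 **`VHSData.cast D h`** — transport of a VHS datum along an equality of weights `h : k = k'` (same local systems, comparison, forms; Hodge structures
  `(D.hodge s).cast h`); `rfl` API.
* §2 **`VHSData.hom D₁ D₂ : VHSData S (k₂ − k₁) := (D₁^∨ ⊗ D₂).cast _`** — fibres `Hom(V₁,ℤ,s, ℤ) ⊗ V₂,ℤ,s`, `V₁,s^∨ ⊗ V₂,s`, transport
  `φ ⊗ u ↦ (φ ∘ γ⁻¹_*) ⊗ γ_* u`, Hodge structure `(H₁^∨ ⊗ H₂).cast` — the source of the tree's isomorphism of Hodge structures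
  `Hom.dualTensorToHom : (H₁^∨ ⊗ H₂).cast ⥲ Hom(H₁, H₂)` (`Motives/HodgeStructureHomDualTensor`); `rfl` API (`hom_toRat_tmul`, transports).
* §3 **`homClass f`**, the class in `Hom(D₁, D₂)_ℤ,s = Hom(V₁,ℤ,s, ℤ) ⊗ V₂,ℤ,s` of a `ℤ`-linear `f : V₁,ℤ,s → V₂,ℤ,s` (Mathlib `dualTensorHomEquiv ℤ`, `V₁,ℤ,s`
  finitely generated free), and **`homRat f : V₁,s →ₗ[ℚ] V₂,s`**, its rationalization — the unique `ℚ`-linear map with `f_ℚ ∘ toRat₁ = toRat₂ ∘ f`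
  (`homRat_toRat`, `homRat_unique`; Mathlib `IsBaseChange.linearMapLeftRightHom` for the base change `isBaseChange_toRatLinear`); transport in
  `Hom(D₁, D₂)` is conjugation (`dualTensorHom_hom_VZ_transport`, **`hom_VZ_transport_homClass`**: `γ_*(homClass f) = homClass (γ_* ∘ f ∘ γ⁻¹_*)`);
  **`dualTensorHom_toRat_hom`**: the comparison `Hom(D₁,D₂)_ℤ,s → Hom(D₁,D₂)_s = V₁,s^∨ ⊗ V₂,s` followed by `V₁,s^∨ ⊗ V₂,s → Hom_ℚ(V₁,s, V₂,s)` is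
  `z ↦ (dualTensorHom ℤ z)_ℚ`; in particular `homClass f ↦ f_ℚ` (`dualTensorHom_toRat_homClass`).
* §4 **`isHodgeAt_homClass_iff`** — for `D₁`, `D₂` of the same weight: `homClass f` is an integral Hodge class of level `0` of `Hom(D₁, D₂)` at `s`
  iff `f_ℚ` is a morphism of Hodge structures `(V₁,s, F) → (V₂,s, F)`, i.e. `(f_ℚ)_ℂ (F^p V₁,s) ⊆ F^p V₂,s` for all `p` (the tree's
  `mem_hodgeClasses_hom_iff` transported along `Hom.dualTensorToHom` ∕ `Hom.homToDualTensor`).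

* §5 **Functoriality**: `homRat_id`, `homRat_comp` (the rationalization of `id` ∕ of `g ∘ f`, by uniqueness), `isHodgeAt_homClass_id` (the identity is an
  integral Hodge class of `End(D)` everywhere), `isHodgeAt_homClass_comp` (integral Hodge classes of `Hom` compose — morphisms of Hodge structures compose).

HONEST SCOPE: as for every `VHSData`, holomorphy and transversality are not recorded; the fibres of `Hom(D₁, D₂)` are `V₁^∨ ⊗ V₂`, identified with
linear maps only through `dualTensorHom` (an isomorphism on each fibre since `V₁,ℤ,s` is finitely generated free, Mathlib `dualTensorHomEquiv`); the
Hodge-class criterion is stated for equal weights (morphisms of Hodge structures), the unequal-weight analogue is not needed here.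

## References

* [Deligne1970] P. Deligne, *Équations différentielles à points singuliers réguliers*, LNM 163 (1970), I.1.
* [Griffiths1970] P. Griffiths, *Periods of integrals on algebraic manifolds III*, Publ. Math. IHÉS 38 (1970), §1.
* [Schmid1973] W. Schmid, *Variation of Hodge structure: the singularities of the period mapping*, Invent. Math. 22 (1973), §2.
* [DeligneHodgeII1971] P. Deligne, *Théorie de Hodge II*, Publ. Math. IHÉS 40 (1971), 1.1.6, 2.1.
* [VoisinHodgeI2002] C. Voisin, *Hodge Theory and Complex Algebraic Geometry I* (CUP, 2002), §7.3.1, Lemma 7.25, §11.1.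
* [CattaniDeligneKaplan1995] E. Cattani, P. Deligne, A. Kaplan, *On the locus of Hodge classes*, J. Amer. Math. Soc. 8 (1995), §1.
* [KlinglerOtwinowskaUrbanik2023] B. Klingler, A. Otwinowska, D. Urbanik, *On the fields of definition of Hodge loci*, Ann. Sci. ÉNS 56 (2023), §1.1.
* [BourbakiAlgebraI1989] N. Bourbaki, *Algebra I*, Ch. II §4 no. 2, §5 no. 4.
-/

noncomputable section

open CategoryTheory
open scoped TensorProduct

namespace Literature.AlgebraicGeometry.Motives

namespace VHSData

variable {S : Type} [TopologicalSpace S] {k k' k₁ k₂ : ℤ}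

/-! ## §1 Transport of a VHS datum along an equality of weights -/

/-- **Transport of a VHS datum along an equality of weights** `h : k = k'`: the same local systems, comparison and forms, the Hodge structures
transported by the tree's `HodgeStructure.cast` (same filtration) and the polarizations by `Polarization.cast` (same form). [cite: DeligneHodgeII1971, 2.1] -/
def cast (D : VHSData S k) (h : k = k') : VHSData S k' where
  VZ := D.VZ
  V := D.V
  ratIso := D.ratIso
  hodge s := (D.hodge s).cast h
  form s := (D.form s).cast h
  transport_form := D.transport_form
  finite_free := D.finite_free

/-- `cast` keeps the integral local system. [cite: DeligneHodgeII1971, 2.1] -/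
@[simp] theorem cast_VZ (D : VHSData S k) (h : k = k') : (D.cast h).VZ = D.VZ := rfl

/-- `cast` keeps the rational local system. [cite: DeligneHodgeII1971, 2.1] -/
@[simp] theorem cast_V (D : VHSData S k) (h : k = k') : (D.cast h).V = D.V := rfl

/-- `cast` keeps the comparison `V_ℤ → V`. [cite: Schmid1973, §2] -/
@[simp] theorem cast_toRat (D : VHSData S k) (h : k = k') (s : S) : (D.cast h).toRat s = D.toRat s := rfl

/-- The Hodge structure of `D.cast h` at `s` is `(D.hodge s).cast h`. [cite: DeligneHodgeII1971, 2.1] -/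
theorem cast_hodge (D : VHSData S k) (h : k = k') (s : S) : (D.cast h).hodge s = (D.hodge s).cast h := rfl

/-- The polarization form of `D.cast h` at `s` is that of `D`. [cite: DeligneHodgeII1971, 2.1] -/
theorem cast_form_form (D : VHSData S k) (h : k = k') (s : S) : ((D.cast h).form s).form = (D.form s).form := rfl

/-- `cast` keeps the Hodge classes: `u` is a Hodge class of level `p` for `D.cast h` iff it is one for `D`. [cite: CattaniDeligneKaplan1995, §1] -/
theorem isHodgeAt_cast_iff (D : VHSData S k) (h : k = k') (s : S) (p : ℤ) (u : D.VZ.fiber s) :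
    (D.cast h).IsHodgeAt s p u ↔ D.IsHodgeAt s p u := Iff.rfl

/-! ## §2 The variation `Hom(D₁, D₂) = D₁^∨ ⊗ D₂` -/

variable (D₁ : VHSData S k₁) (D₂ : VHSData S k₂)

/-- **The variation `Hom(D₁, D₂)` of two polarized variations**, realised as `D₁^∨ ⊗ D₂` (Deligne 1970, I.1: `Hom(V₁, V₂) = V₁^∨ ⊗ V₂` in the
`⊗`-category of local systems; Griffiths 1970 §1 ∕ Schmid 1973 §2: variations are stable under `Hom`), of weight `k₂ − k₁` (weight `−k₁ + k₂` of
`D₁^∨ ⊗ D₂` transported by `cast`).  Its Hodge structure at `s` is `(H₁^∨ ⊗ H₂).cast`, isomorphic to the internal `Hom(H₁, H₂)` by the tree's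
`Hom.dualTensorToHom`. [cite: Deligne1970, I.1] [cite: Griffiths1970, §1] [cite: Schmid1973, §2] [cite: DeligneHodgeII1971, 1.1.6] -/
def hom : VHSData S (k₂ - k₁) :=
  (D₁.dual.tensor D₂).cast (neg_add_eq_sub k₁ k₂)

/-- The integral local system of `Hom(D₁, D₂)` is `V₁,ℤ^∨ ⊗ V₂,ℤ`. [cite: Deligne1970, I.1] -/
@[simp] theorem hom_VZ : (D₁.hom D₂).VZ = D₁.VZ.dual.tensor D₂.VZ := rfl

/-- The rational local system of `Hom(D₁, D₂)` is `V₁^∨ ⊗ V₂`. [cite: Deligne1970, I.1] -/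
@[simp] theorem hom_V : (D₁.hom D₂).V = D₁.V.dual.tensor D₂.V := rfl

/-- The Hodge structure of `Hom(D₁, D₂)` at `s` is `(H₁^∨ ⊗ H₂).cast` (the instances being those of the tree: `hodgeTensorFacts_holds`,
`finite_fiber`). [cite: DeligneHodgeII1971, 1.1.6] -/
theorem hom_hodge [HodgeTensorFacts.{0, 0}] (s : S) :
    (D₁.hom D₂).hodge s = (haveI : Module.Finite ℚ (D₁.V.fiber s) := D₁.finite_fiber s
      ((D₁.hodge s).dual.tensor (D₂.hodge s)).cast (neg_add_eq_sub k₁ k₂)) := rfl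

/-- The comparison of `Hom(D₁, D₂)` on a pure tensor: `toRat(φ ⊗ u) = toRat^∨ φ ⊗ toRat u`. [cite: Schmid1973, §2] -/
theorem hom_toRat_tmul (s : S) (φ : Module.Dual ℤ (D₁.VZ.fiber s)) (u : D₂.VZ.fiber s) :
    (D₁.hom D₂).toRat s (φ ⊗ₜ[ℤ] u) = D₁.dual.toRat s (φ : D₁.dual.VZ.fiber s) ⊗ₜ[ℚ] D₂.toRat s u := rfl

/-- Integral transport of `Hom(D₁, D₂)` on a pure tensor: `γ_*(φ ⊗ u) = (φ ∘ γ⁻¹_*) ⊗ γ_* u` — i.e. the lattice map `m ↦ φ(m) u` is transported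
to `γ_* ∘ (m ↦ φ(m) u) ∘ γ⁻¹_*`. [cite: Deligne1970, I.1] -/
theorem hom_VZ_transport_tmul {s t : S} (γ : Path.Homotopic.Quotient s t) (φ : Module.Dual ℤ (D₁.VZ.fiber s)) (u : D₂.VZ.fiber s) :
    (D₁.hom D₂).VZ.transport γ (φ ⊗ₜ[ℤ] u) = (φ ∘ₗ D₁.VZ.transport γ.symm) ⊗ₜ[ℤ] D₂.VZ.transport γ u := rfl

/-- Rational transport of `Hom(D₁, D₂)` on a pure tensor. [cite: Deligne1970, I.1] -/
theorem hom_V_transport_tmul {s t : S} (γ : Path.Homotopic.Quotient s t) (φ : Module.Dual ℚ (D₁.V.fiber s)) (v : D₂.V.fiber s) :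
    (D₁.hom D₂).V.transport γ (φ ⊗ₜ[ℚ] v) = (φ ∘ₗ D₁.V.transport γ.symm) ⊗ₜ[ℚ] D₂.V.transport γ v := rfl

/-! ## §3 The lattice class and the rationalization of a `ℤ`-linear map `V₁,ℤ,s → V₂,ℤ,s` -/

/-- **The class of a `ℤ`-linear map `f : V₁,ℤ,s → V₂,ℤ,s` in the integral fibre `Hom(V₁,ℤ,s, ℤ) ⊗ V₂,ℤ,s` of `Hom(D₁, D₂)`** (inverse of Mathlib's
`dualTensorHomEquiv ℤ`, an isomorphism because `V₁,ℤ,s` is finitely generated free: Bourbaki, *Algebra* II §4 no. 2). [cite: BourbakiAlgebraI1989, Ch. II §4 no. 2]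
[cite: Deligne1970, I.1] -/
def homClass (s : S) (f : D₁.VZ.fiber s →ₗ[ℤ] D₂.VZ.fiber s) : (D₁.hom D₂).VZ.fiber s :=
  haveI : Module.Free ℤ (D₁.VZ.fiber s) := D₁.free s
  haveI : Module.Finite ℤ (D₁.VZ.fiber s) := D₁.finite s
  (dualTensorHomEquiv ℤ (D₁.VZ.fiber s) (D₂.VZ.fiber s)).symm f

/-- `homClass f` contracts back to `f`: `dualTensorHom (homClass f) = f`. [cite: BourbakiAlgebraI1989, Ch. II §4 no. 2] -/
theorem dualTensorHom_homClass (s : S) (f : D₁.VZ.fiber s →ₗ[ℤ] D₂.VZ.fiber s) :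
    dualTensorHom ℤ (D₁.VZ.fiber s) (D₂.VZ.fiber s) (D₁.homClass D₂ s f : Module.Dual ℤ (D₁.VZ.fiber s) ⊗[ℤ] D₂.VZ.fiber s) = f := by
  haveI : Module.Free ℤ (D₁.VZ.fiber s) := D₁.free s
  haveI : Module.Finite ℤ (D₁.VZ.fiber s) := D₁.finite s
  exact dualTensorHomEquivOfBasis_symm_cancel_right _ f

/-- `homClass` is additive. [cite: BourbakiAlgebraI1989, Ch. II §4 no. 2] -/
theorem homClass_add (s : S) (f g : D₁.VZ.fiber s →ₗ[ℤ] D₂.VZ.fiber s) :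
    D₁.homClass D₂ s (f + g) = D₁.homClass D₂ s f + D₁.homClass D₂ s g :=
  map_add _ f g

/-- **Transport in `Hom(D₁, D₂)` is conjugation by the parallel transports**: contracting the transport of `z ∈ Hom(V₁,ℤ,s, ℤ) ⊗ V₂,ℤ,s` along
`γ` gives `γ_* ∘ (contraction of z) ∘ γ⁻¹_*` (on `φ ⊗ u`: `m ↦ φ(γ⁻¹_* m) · γ_* u`). [cite: Deligne1970, I.1] -/
theorem dualTensorHom_hom_VZ_transport {s t : S} (γ : Path.Homotopic.Quotient s t) (z : (D₁.hom D₂).VZ.fiber s) :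
    dualTensorHom ℤ (D₁.VZ.fiber t) (D₂.VZ.fiber t)
        ((D₁.hom D₂).VZ.transport γ z : Module.Dual ℤ (D₁.VZ.fiber t) ⊗[ℤ] D₂.VZ.fiber t) =
      D₂.VZ.transport γ ∘ₗ
        dualTensorHom ℤ (D₁.VZ.fiber s) (D₂.VZ.fiber s) (z : Module.Dual ℤ (D₁.VZ.fiber s) ⊗[ℤ] D₂.VZ.fiber s) ∘ₗ
          D₁.VZ.transport γ.symm := by
  let L : Module.Dual ℤ (D₁.VZ.fiber s) ⊗[ℤ] D₂.VZ.fiber s →+ (D₁.VZ.fiber t →ₗ[ℤ] D₂.VZ.fiber t) :=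
    (dualTensorHom ℤ (D₁.VZ.fiber t) (D₂.VZ.fiber t)).toAddMonoidHom.comp ((D₁.hom D₂).VZ.transport γ).toAddMonoidHom
  let R : Module.Dual ℤ (D₁.VZ.fiber s) ⊗[ℤ] D₂.VZ.fiber s →+ (D₁.VZ.fiber t →ₗ[ℤ] D₂.VZ.fiber t) :=
    AddMonoidHom.mk' (fun w => D₂.VZ.transport γ ∘ₗ dualTensorHom ℤ (D₁.VZ.fiber s) (D₂.VZ.fiber s) w ∘ₗ D₁.VZ.transport γ.symm)
      fun x y => by rw [map_add, LinearMap.add_comp, LinearMap.comp_add]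
  suffices h : L = R from DFunLike.congr_fun h z
  refine AddMonoidHom.ext fun w => ?_
  induction w using TensorProduct.induction_on with
  | zero => rw [map_zero, map_zero]
  | tmul φ u =>
    change dualTensorHom ℤ (D₁.VZ.fiber t) (D₂.VZ.fiber t) ((φ ∘ₗ D₁.VZ.transport γ.symm) ⊗ₜ[ℤ] D₂.VZ.transport γ u) =
      D₂.VZ.transport γ ∘ₗ dualTensorHom ℤ (D₁.VZ.fiber s) (D₂.VZ.fiber s) (φ ⊗ₜ[ℤ] u) ∘ₗ D₁.VZ.transport γ.symm
    refine LinearMap.ext fun m => ?_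
    simp only [dualTensorHom_apply, LinearMap.comp_apply]
    exact ((D₂.VZ.transport γ).map_smul (φ (D₁.VZ.transport γ.symm m)) u).symm
  | add x y hx hy => rw [map_add, map_add, hx, hy]

/-- **The flat continuation of a lattice map is its conjugate by parallel transport**: the transport of `homClass f` along `γ` is the class of
`γ_* ∘ f ∘ γ⁻¹_*` — so the determinations of `homClass f` at `t` are the classes of the conjugates of `f`, and «`f` stays a morphism of Hodge
structures along `γ`» is membership of `t` in a Hodge locus of `Hom(D₁, D₂)`. [cite: Deligne1970, I.1] [cite: CattaniDeligneKaplan1995, §1] -/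
theorem hom_VZ_transport_homClass {s t : S} (γ : Path.Homotopic.Quotient s t) (f : D₁.VZ.fiber s →ₗ[ℤ] D₂.VZ.fiber s) :
    (D₁.hom D₂).VZ.transport γ (D₁.homClass D₂ s f) = D₁.homClass D₂ t (D₂.VZ.transport γ ∘ₗ f ∘ₗ D₁.VZ.transport γ.symm) := by
  haveI : Module.Free ℤ (D₁.VZ.fiber t) := D₁.free t
  haveI : Module.Finite ℤ (D₁.VZ.fiber t) := D₁.finite t
  apply (dualTensorHomEquiv ℤ (D₁.VZ.fiber t) (D₂.VZ.fiber t)).injective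
  rw [dualTensorHomEquiv, dualTensorHomEquivOfBasis_apply, dualTensorHomEquivOfBasis_apply, dualTensorHom_hom_VZ_transport,
    dualTensorHom_homClass, dualTensorHom_homClass]

/-- **The rationalization `f_ℚ : V₁,s → V₂,s` of a `ℤ`-linear `f : V₁,ℤ,s → V₂,ℤ,s`**: the base change of `f` along `ℤ → ℚ` read through the
comparisons `toRat` (Mathlib `IsBaseChange.linearMapLeftRightHom` for `isBaseChange_toRatLinear`; Bourbaki, *Algebra* II §5 no. 4).
[cite: BourbakiAlgebraI1989, Ch. II §5 no. 4] [cite: Schmid1973, §2] -/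
def homRat (s : S) (f : D₁.VZ.fiber s →ₗ[ℤ] D₂.VZ.fiber s) : D₁.V.fiber s →ₗ[ℚ] D₂.V.fiber s :=
  IsBaseChange.linearMapLeftRightHom (D₁.isBaseChange_toRatLinear ⟨s⟩) (D₂.toRatLinear ⟨s⟩) f

/-- **`f_ℚ (toRat m) = toRat (f m)`.** [cite: BourbakiAlgebraI1989, Ch. II §5 no. 4] [cite: Schmid1973, §2] -/
theorem homRat_toRat (s : S) (f : D₁.VZ.fiber s →ₗ[ℤ] D₂.VZ.fiber s) (m : D₁.VZ.fiber s) :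
    D₁.homRat D₂ s f (D₁.toRat s m) = D₂.toRat s (f m) :=
  IsBaseChange.linearMapLeftRightHom_comp_apply (D₁.isBaseChange_toRatLinear ⟨s⟩) (D₂.toRatLinear ⟨s⟩) f m

/-- **Uniqueness of the rationalization**: a `ℚ`-linear `g : V₁,s → V₂,s` with `g (toRat m) = toRat (f m)` for all `m ∈ V₁,ℤ,s` is `f_ℚ`
(`V₁,ℤ,s` spans `V₁,s` over `ℚ`). [cite: BourbakiAlgebraI1989, Ch. II §5 no. 4] [cite: Schmid1973, §2] -/
theorem homRat_unique (s : S) (f : D₁.VZ.fiber s →ₗ[ℤ] D₂.VZ.fiber s) (g : D₁.V.fiber s →ₗ[ℚ] D₂.V.fiber s)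
    (hg : ∀ m : D₁.VZ.fiber s, g (D₁.toRat s m) = D₂.toRat s (f m)) : g = D₁.homRat D₂ s f :=
  (D₁.isBaseChange_toRatLinear ⟨s⟩).algHom_ext _ _ fun m => by rw [toRatLinear_apply, hg, homRat_toRat]

/-- `homRat` is additive. [cite: BourbakiAlgebraI1989, Ch. II §5 no. 4] -/
theorem homRat_add (s : S) (f g : D₁.VZ.fiber s →ₗ[ℤ] D₂.VZ.fiber s) :
    D₁.homRat D₂ s (f + g) = D₁.homRat D₂ s f + D₁.homRat D₂ s g :=
  map_add _ f g

/-- **The comparison of `Hom(D₁, D₂)` is compatible with contraction**: for every `z ∈ Hom(V₁,ℤ,s, ℤ) ⊗ V₂,ℤ,s`, contracting its image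
`toRat z ∈ V₁,s^∨ ⊗ V₂,s` to a `ℚ`-linear map gives the rationalization of the contraction of `z` (on `φ ⊗ u`: both are
`toRat m ↦ φ(m) · toRat u`, `dual_toRat_apply`). [cite: BourbakiAlgebraI1989, Ch. II §4 no. 2 and §5 no. 4] [cite: Schmid1973, §2] -/
theorem dualTensorHom_toRat_hom (s : S) (z : Module.Dual ℤ (D₁.VZ.fiber s) ⊗[ℤ] D₂.VZ.fiber s) :
    dualTensorHom ℚ (D₁.V.fiber s) (D₂.V.fiber s) ((D₁.hom D₂).toRat s z : Module.Dual ℚ (D₁.V.fiber s) ⊗[ℚ] D₂.V.fiber s) =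
      D₁.homRat D₂ s (dualTensorHom ℤ (D₁.VZ.fiber s) (D₂.VZ.fiber s) z) := by
  -- both sides as additive maps of `z` (the integral fibre of `Hom(D₁, D₂)` is `Hom(V₁,ℤ,s, ℤ) ⊗ V₂,ℤ,s` by `rfl`)
  let L : Module.Dual ℤ (D₁.VZ.fiber s) ⊗[ℤ] D₂.VZ.fiber s →+ (D₁.V.fiber s →ₗ[ℚ] D₂.V.fiber s) :=
    (dualTensorHom ℚ (D₁.V.fiber s) (D₂.V.fiber s)).toAddMonoidHom.comp ((D₁.hom D₂).toRat s)
  let R : Module.Dual ℤ (D₁.VZ.fiber s) ⊗[ℤ] D₂.VZ.fiber s →+ (D₁.V.fiber s →ₗ[ℚ] D₂.V.fiber s) :=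
    (IsBaseChange.linearMapLeftRightHom (D₁.isBaseChange_toRatLinear ⟨s⟩) (D₂.toRatLinear ⟨s⟩)).toAddMonoidHom.comp
      (dualTensorHom ℤ (D₁.VZ.fiber s) (D₂.VZ.fiber s)).toAddMonoidHom
  suffices h : L = R from DFunLike.congr_fun h z
  refine AddMonoidHom.ext fun w => ?_
  induction w using TensorProduct.induction_on with
  | zero => rw [map_zero, map_zero]
  | tmul φ u =>
    change dualTensorHom ℚ (D₁.V.fiber s) (D₂.V.fiber s) ((D₁.hom D₂).toRat s (φ ⊗ₜ[ℤ] u)) =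
      D₁.homRat D₂ s (dualTensorHom ℤ (D₁.VZ.fiber s) (D₂.VZ.fiber s) (φ ⊗ₜ[ℤ] u))
    refine D₁.homRat_unique D₂ s _ _ fun m => ?_
    conv_rhs => rw [dualTensorHom_apply]
    change dualTensorHom ℚ (D₁.V.fiber s) (D₂.V.fiber s)
        ((show Module.Dual ℚ (D₁.V.fiber s) from D₁.dual.toRat s (φ : D₁.dual.VZ.fiber s)) ⊗ₜ[ℚ] D₂.toRat s u) (D₁.toRat s m) =
      D₂.toRatLinear ⟨s⟩ _
    rw [dualTensorHom_apply, D₁.dual_toRat_apply, (D₂.toRatLinear ⟨s⟩).map_smul (φ m) u, ← Int.cast_smul_eq_zsmul ℚ, toRatLinear_apply]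
  | add x y hx hy => rw [map_add, map_add, hx, hy]

/-- **The class of `f` rationalizes to `f_ℚ`**: contracting `toRat (homClass f) ∈ V₁,s^∨ ⊗ V₂,s` gives `f_ℚ`.
[cite: BourbakiAlgebraI1989, Ch. II §4 no. 2 and §5 no. 4] [cite: Schmid1973, §2] -/
theorem dualTensorHom_toRat_homClass (s : S) (f : D₁.VZ.fiber s →ₗ[ℤ] D₂.VZ.fiber s) :
    dualTensorHom ℚ (D₁.V.fiber s) (D₂.V.fiber s)
        ((D₁.hom D₂).toRat s (D₁.homClass D₂ s f) : Module.Dual ℚ (D₁.V.fiber s) ⊗[ℚ] D₂.V.fiber s) = D₁.homRat D₂ s f := by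
  rw [dualTensorHom_toRat_hom, dualTensorHom_homClass]

end VHSData

/-! ## §4 Integral Hodge classes of `Hom(D₁, D₂)` = lattice maps whose rationalization is a morphism of Hodge structures -/

namespace VHSData

variable {S : Type} [TopologicalSpace S] {k : ℤ} (D₁ D₂ : VHSData S k)

/-- **A lattice map is an integral Hodge class of `Hom(D₁, D₂)` iff its rationalization is a morphism of Hodge structures** (Deligne, Hodge II 1.1.6 ∕
2.1; Voisin I, Lemma 7.25: the Hodge classes of type `(0,0)` of `Hom(H₁, H₂) ≅ H₁^∨ ⊗ H₂` are the morphisms).  For `D₁`, `D₂` of the same weight,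
`s ∈ S` and `f : V₁,ℤ,s → V₂,ℤ,s` `ℤ`-linear: `homClass f` is a Hodge class of level `0` of `Hom(D₁, D₂)` at `s` iff `(f_ℚ)_ℂ (F^p V₁,s) ⊆ F^p V₂,s`
for every `p` — the condition «`f_s` respects the Hodge structures» defining endomorphism ∕ isogeny ∕ Noether–Lefschetz-type loci, which are thus
Hodge loci of the variation `Hom(D₁, D₂)` in the sense of Cattani–Deligne–Kaplan. [cite: DeligneHodgeII1971, 1.1.6 and 2.1] [cite: VoisinHodgeI2002, Lemma 7.25]
[cite: CattaniDeligneKaplan1995, §1] [cite: KlinglerOtwinowskaUrbanik2023, §1.1] -/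
theorem isHodgeAt_homClass_iff (s : S) (f : D₁.VZ.fiber s →ₗ[ℤ] D₂.VZ.fiber s) :
    (D₁.hom D₂).IsHodgeAt s 0 (D₁.homClass D₂ s f) ↔
      ∀ p : ℤ, ((D₁.hodge s).F p).map ((D₁.homRat D₂ s f).baseChange ℂ) ≤ (D₂.hodge s).F p := by
  haveI : HodgeTensorFacts.{0, 0} := hodgeTensorFacts_holds
  haveI : Module.Finite ℚ (D₁.V.fiber s) := D₁.finite_fiber s
  rw [← HodgeStructure.mem_hodgeClasses_hom_iff (D₁.hodge s) (D₂.hodge s)]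
  -- the Hodge classes of `(H₁^∨ ⊗ H₂).cast` and of `Hom(H₁, H₂)` correspond under the isomorphism `dualTensorToHom` ∕ `homToDualTensor`
  have key : (HodgeStructure.Hom.dualTensorToHom (D₁.hodge s) (D₂.hodge s)).toLinearMap ((D₁.hom D₂).toRat s (D₁.homClass D₂ s f)) =
      D₁.homRat D₂ s f := by
    rw [HodgeStructure.Hom.dualTensorToHom_toLinearMap, LinearEquiv.coe_toLinearMap, dualTensorHomEquiv, dualTensorHomEquivOfBasis_apply]
    exact D₁.dualTensorHom_toRat_homClass D₂ s f
  constructor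
  · intro h
    rw [← key]
    exact HodgeStructure.Hom.apply_mem_hodgeClasses _ h
  · intro h
    have h' := HodgeStructure.Hom.apply_mem_hodgeClasses (HodgeStructure.Hom.homToDualTensor (D₁.hodge s) (D₂.hodge s)) h
    rw [← key, HodgeStructure.Hom.homToDualTensor_dualTensorToHom_apply] at h'
    exact h'

/-- **Corollary (morphism form)**: if `f_ℚ` underlies a morphism of Hodge structures `(V₁,s, F) → (V₂,s, F)`, then `homClass f` is an integral Hodge
class of `Hom(D₁, D₂)` at `s`. [cite: DeligneHodgeII1971, 1.1.6 and 2.1] [cite: VoisinHodgeI2002, Lemma 7.25] -/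
theorem isHodgeAt_homClass_of_hom (s : S) (f : D₁.VZ.fiber s →ₗ[ℤ] D₂.VZ.fiber s) (φ : HodgeStructure.Hom (D₁.hodge s) (D₂.hodge s))
    (hφ : φ.toLinearMap = D₁.homRat D₂ s f) : (D₁.hom D₂).IsHodgeAt s 0 (D₁.homClass D₂ s f) := by
  rw [isHodgeAt_homClass_iff, ← hφ]
  exact φ.map_F_le

end VHSData


/-! ## §5 Identity and composition: the rationalization is functorial, integral Hodge classes of `Hom` compose -/

namespace VHSData

variable {S : Type} [TopologicalSpace S] {k k₁ k₂ k₃ : ℤ}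

/-- The rationalization of the identity of `V_ℤ,s` is the identity of `V_s`. [cite: BourbakiAlgebraI1989, Ch. II §5 no. 4] -/
theorem homRat_id (D : VHSData S k) (s : S) : D.homRat D s LinearMap.id = LinearMap.id :=
  (D.homRat_unique D s LinearMap.id LinearMap.id fun _ => rfl).symm

/-- The rationalization of a composite is the composite of the rationalizations (uniqueness, `homRat_unique`). [cite: BourbakiAlgebraI1989, Ch. II §5 no. 4] -/
theorem homRat_comp (D₁ : VHSData S k₁) (D₂ : VHSData S k₂) (D₃ : VHSData S k₃) (s : S) (f : D₁.VZ.fiber s →ₗ[ℤ] D₂.VZ.fiber s)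
    (g : D₂.VZ.fiber s →ₗ[ℤ] D₃.VZ.fiber s) : D₁.homRat D₃ s (g ∘ₗ f) = D₂.homRat D₃ s g ∘ₗ D₁.homRat D₂ s f :=
  (D₁.homRat_unique D₃ s (g ∘ₗ f) _ fun m => by simp only [LinearMap.comp_apply, homRat_toRat]).symm

/-- **The identity is an integral Hodge class of `End(D) = Hom(D, D)` at every point.** [cite: DeligneHodgeII1971, 1.1.6 and 2.1] [cite: VoisinHodgeI2002, Lemma 7.25] -/
theorem isHodgeAt_homClass_id (D : VHSData S k) (s : S) : (D.hom D).IsHodgeAt s 0 (D.homClass D s LinearMap.id) := by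
  rw [isHodgeAt_homClass_iff, homRat_id]
  intro p
  rw [LinearMap.baseChange_id, Submodule.map_id]

/-- **Integral Hodge classes of `Hom` compose**: if `f : V₁,ℤ,s → V₂,ℤ,s` and `g : V₂,ℤ,s → V₃,ℤ,s` are integral Hodge classes of `Hom(D₁, D₂)`,
`Hom(D₂, D₃)` at `s` (same weights), then `g ∘ f` is one of `Hom(D₁, D₃)` (morphisms of Hodge structures compose).
[cite: DeligneHodgeII1971, 1.1.6 and 2.1] [cite: VoisinHodgeI2002, Lemma 7.25] -/
theorem isHodgeAt_homClass_comp (D₁ D₂ D₃ : VHSData S k) (s : S) {f : D₁.VZ.fiber s →ₗ[ℤ] D₂.VZ.fiber s}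
    {g : D₂.VZ.fiber s →ₗ[ℤ] D₃.VZ.fiber s} (hf : (D₁.hom D₂).IsHodgeAt s 0 (D₁.homClass D₂ s f))
    (hg : (D₂.hom D₃).IsHodgeAt s 0 (D₂.homClass D₃ s g)) : (D₁.hom D₃).IsHodgeAt s 0 (D₁.homClass D₃ s (g ∘ₗ f)) := by
  rw [isHodgeAt_homClass_iff] at hf hg ⊢
  intro p
  rw [homRat_comp, LinearMap.baseChange_comp, Submodule.map_comp]
  exact (Submodule.map_mono (hf p)).trans (hg p)

end VHSData

end Literature.AlgebraicGeometry.Motives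

end
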